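import Summits.BirchSwinnertonDyer.Rank1Residual.Additive.X4RankOneKimKatoConsistencyBudget
import Summits.BirchSwinnertonDyer.Rank1Residual.Additive.X4RankOneKimKatoConsistencyBudgetPotMult
import HarnessLib

/-!
# KURREG register ADDENDUM A5 (index-`n₀` claims): the RECORD-LITERAL row shapes — part 2: `p = 3`
# (K1-n₀ on Gord3 ∩ surj(3) and K1-M-n₀ on (M)@3, gap form and WITH Conjecture 1.10; the twist datum
# DISCHARGED at `3`; `v₁` read off the census record)
# (cell `b2b-bsdres`, census cell, seat `b2b-bsdres-census-ctyper1` = conjecture-typer 1 /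
# KURREG joint-table owner, gen 5; part 1 = `CensusKurregRecordRows.lean`, `p ≥ 5`)

HONEST FRAMING (cell `b2b-bsdres`, run/shared/lean/b2b/bsd-rank1-residual/, verbatim in every
file): the goal of the cell is to DELETE the COMBINATION-SHAPED residual classes of the
Birch–Swinnerton-Dyer formula for ALL analytic-rank `≤ 1` elliptic curves over `ℚ` — "full BSD
formula for every rank `≤ 1` curve in class `C`" assembled STRICTLY from published theorems — so
that the rank-`≤ 1` remainder becomes exactly the CONSTRUCTION-SHAPED classes, which are TYPED
(missing-input `Prop`s), NOT attempted. This is not "finishing BSD". Census cell: research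
instrumentation; census / instrument output (Q6 records, Kurihara numbers, `p`-adic heights) =
EVIDENCE / per-pair CERTIFICATE-EVIDENCE for the kernel cell, never a Literature fact; nothing
booked; no mark / label moved (O7-ord OPEN; X3♯/X4♯ CONSTRUCTION-SHAPED). Theorems only (no `def`,
no named fact); every theorem is an implication from OUR `∂`-clause conjecture
`X4SharpThreeKimRankOnePartial` (typed, a HYPOTHESIS `h3`), Kato 17.4 (3) (`hKato`), GZK, modularity,
`hmodD`, the per-pair records, and — where named — Kim's Conjecture 1.10 at the pair
(`X4.KimTamagawaDefectAt`, `@[conjecture]`, a HYPOTHESIS `hT`).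

## What and why

Register `cells/n1011/PREDICTIONS-KURREG.md` §9 ADDENDUM A5 (n1011-p17 GEN 2, 2026-08-21T10:05Z,
pre-data): "K1-n₀ / K1-M-n₀ (`p = 3`, JOINT test {our `∂`-clause conjecture ∧ Conj 1.10}):
`d1 + vReg₃ (+ ord₃ ell on (G-ord)) = v1 + 1`; gap form without Conj 1.10:
`d1 − dinf + vReg₃ + ord₃∏c (+ ord₃ ell) = v1 + 1 + 2 ord₃ #tors`" with columns `n0` = the Q6 ODD record
`CensusQ6.GordOddFirstUnitIndexAt W 3 n₀` / `CensusQ6.MultOddFirstUnitIndexAt W 3 n₀` (`3 ≡ 3 mod 4`),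
`v1` = census-ctyper1's `CensusQ6.GordCoeffValAt W 3 1 v₁` / `MultCoeffValAt W 3 1 v₁` (p258170), and
`budget_ok` = `BudgetLeLambdaAt 3 W n₀`. The kernels of record, n1011-p17's
`ClassX4Gord.kuriharaGap_identity_three_rankOne_of_kimPartial_of_katoHalf_of_coeffCert_of_budget` (p260318)
and `ClassX4M.kuriharaGap_identity_three_rankOne_of_kimPartial_of_katoHalf_of_firstUnitIndex_of_budget`
(p260326), keep the twist-model binders (`V, C, f, ϖ`, `hne₁ : c₁(ϖB) ≠ 0`, on (M) `ap`) and state the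
right side with the raw valuation `v₃(c₁(ϖB))`; no Conjecture-1.10 form at index `n₀` exists at `3`.
This file prints the RECORD-LITERAL forms — every hypothesis a joint-table column or a published /
typed fact:

* (G-ord) gap form `…_of_gordOddFirstUnitIndexAt_of_gordCoeffValAt_of_budget` and its non-anomalous
  specialisation (`ℓ = 1`: the register's scored K1 rows are the non-anomalous ones, A1):
  `∂¹ − ∂^∞ + vReg₃ + ord₃ ∏c (+ ord₃ ℓ) = v₁ + 1 + 2 ord₃ #tors`;
* (G-ord) WITH Conj. 1.10 `…_of_tamagawaDefect_…` (+ `_of_nonAnomalous`): `∂¹ + vReg₃ (+ ord₃ ℓ) = v₁ + 1`;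
* (M) gap form `ClassX4M.…_of_multOddFirstUnitIndexAt_of_multCoeffValAt_of_budget`:
  `∂¹ − ∂^∞ + vReg₃ + ord₃ ∏c = v₁ + 1 + 2 ord₃ #tors`; WITH Conj. 1.10: `∂¹ + vReg₃ = v₁ + 1`.

New steps only: the discharge of the twist datum at `3` — (G-ord): `e = 2` is automatic at `3`
(p14's `semistabilityIndex_eq_two_of_typeG_three`), `ClassX4Gord.exists_goodOrd_pStar_twist_model`,
`hmodD`, the period ratio of the parity (`exists_periodRatio_parity`), ordinarity of the model
(`isOrdinaryAt_of_goodOrd_or_mult_of_model_twist`), the Q6 odd record ⟹ the index-`n₀` certificate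
(`CensusQ6.branchUnitCoeffAt_of_gordOddFirstUnitIndexAt`); (M): `ClassX4M.exists_mult_pStar_twist_model`,
`a₃(f♭) = ±1` by the reduction sign — then the raw valuation is rewritten by the record
(`GordCoeffValAt.coeff_ne_zero_and_valuation_eq` / `MultCoeffValAt.…`) and Conj. 1.10 substituted
(`3 ∤ #E(ℚ)_tors` from irreducibility). Per pair; EVIDENCE-conditional in its record binders; nothing
about any curve is asserted; nothing booked; a violation on a scored row refutes an instrument, a
certificate, or the named conjunction AT THAT PAIR (register §5/§8) — never a mark.

References: [Kim2022StructureSelmer] Thm. 1.9 (6), Conj. 1.10 (PDF p. 8); [Kato2004Asterisque] Thm.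
17.4 (3) (p. 273); [Delbourgo2002] Thm. (B) (p. 40), `ℓ_p = 1` (p. 39); [MazurTateTeitelbaum1986Invent]
§I.10, §I.13 (the branch series of the records; nothing asserted). Cell files:
cells/n1011/PREDICTIONS-KURREG.md §9 A1/A5; HOME/b2b-bsdres-n1011-p17/KURREG-KERNELS.md;
HOME/b2b-bsdres-census-ctyper1/kurreg/ASSEMBLY-SPEC.md.
-/

set_option autoImplicit false

noncomputable section

open scoped Classical MatrixGroups ModularForm NumberField

open CongruenceSubgroup WeierstrassCurve NumberField Literature.NumberTheory.EllipticCurves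
  Literature.NumberTheory.EllipticCurves.ModularForms
  Literature.NumberTheory.EllipticCurves.Rank1Residual
  Literature.NumberTheory.EllipticCurves.Rank1Residual.Typed
  Literature.NumberTheory.EllipticCurves.Delbourgo2002
  Literature.NumberTheory.GaloisRepresentations
  Summit.BirchSwinnertonDyer.Rank1Residual.AdditivePotMult
  IsDedekindDomain

namespace Summit.BirchSwinnertonDyer.Rank1Residual.Additive

/-! ### §1 `p = 3`, (G-ord): K1-n₀ in RECORD-LITERAL form (twist datum discharged at `3`) -/

section Three

variable {W : WeierstrassCurve ℚ} [W.IsElliptic] [W.IsGloballyMinimal] [hp : Fact (Nat.Prime 3)]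

/-- **K1-n₀ (G-ord), `p = 3`, gap form, RECORD-LITERAL**: X4♯(G-ord)@3 ∩ {`ρ̄₃` onto}, `r_an = 1`, Q6 ODD
record at index `n₀` (`CensusQ6.GordOddFirstUnitIndexAt W 3 n₀`, column `n0`) + budget at `3` + valuation
RECORD `CensusQ6.GordCoeffValAt W 3 1 v₁` (column `v1`) + (B)-datum + parametrisation datum with ONE non-zero
Kurihara number: **`∂^{(1)} − ∂^{(∞)} + v(Reg₃(E,Dh)) + ord₃ ∏c + ord₃ ℓ = v₁ + 1 + 2·ord₃ #E(ℚ)_tors`** —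
modulo OUR conjecture `X4SharpThreeKimRankOnePartial` + Kato 17.4 (3) + GZK + modularity + `hmodD`; NO
Conj. 1.10. The good-ordinary twist datum is DISCHARGED (`e = 2` automatic at `3`:
`semistabilityIndex_eq_two_of_typeG_three`; `ClassX4Gord.exists_goodOrd_pStar_twist_model`; period ratio
of the parity; `v₁` read off the record). Per pair; nothing booked.
[cite: Kim2022StructureSelmer, Thm. 1.9 (6) (PDF p. 8)] [cite: Kato2004Asterisque, Thm. 17.4 (3) (p. 273)]
[cite: Delbourgo2002, Theorem (B) (p. 40)] -/
theorem ClassX4Gord.kuriharaGap_identity_three_rankOne_of_kimPartial_of_katoHalf_of_gordOddFirstUnitIndexAt_of_gordCoeffValAt_of_budget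
    (h3 : X4SharpThreeKimRankOnePartial)
    (hKato : Wuthrich2014.kato_halfEigenCharIdeal_dvd_cyclotomicPrime_of_surjective)
    (hmodD : nonempty_modularParametrizationData)
    (hGZK : rank_eq_analyticRank_of_analyticRank_le_one) (hmod : hasEntireLFunction_rat)
    (hX : ClassX4Gord W 3) (hsurj : Surj W 3) (hr : W.analyticRank = 1) {n₀ : ℕ}
    (hrec : CensusQ6.GordOddFirstUnitIndexAt W 3 n₀) (hbud : BudgetLeLambdaAt 3 W n₀)
    {v₁ : ℤ} (hv1 : CensusQ6.GordCoeffValAt W 3 1 v₁)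
    {Dh : PAdicHeightData W 3} (hB : LeadingTermClauses W 3 Dh)
    {N : ℕ} [NeZero N] (D : ModularParametrizationData W N) (hc : ¬ (3 : ℤ) ∣ D.maninConstant)
    (hper : ∃ u : ℚ, ‖(u : ℚ_[3])‖ = 1 ∧ W.realPeriodRat = u * plusPeriod D.f)
    (hne : kuriharaPartial W 3 D.f 1 ≠ ⊤) :
    ∃ ℓ : ℕ, ℓ ∣ 3 ^ 2 ∧ (ReductionNonAnomalous W 3 → ℓ = 1) ∧
      ∃ m d : ℕ, kuriharaPartial W 3 D.f 1 = m ∧ kuriharaPartialInfty W 3 D.f = d ∧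
        (m : ℤ) - d + (padicRegulator Dh).valuation + padicValNat 3 W.tamagawaProduct + padicValNat 3 ℓ =
          v₁ + 1 + 2 * padicValNat 3 W.torsionOrder := by
  -- the defect is `2` at `3` on a (G)-row, so the good ordinary twist model by `p* = −3` exists
  have he : semistabilityIndex W 3 = 2 :=
    semistabilityIndex_eq_two_of_typeG_three W hX.typeGOrd.typeG hX.addv.2
  obtain ⟨V, iV, iVm, C, hV, hC⟩ := hX.exists_goodOrd_pStar_twist_model W 3 he
  haveI : NeZero (V.conductorNorm ℤ) := ⟨(V.conductorNorm_pos_holds).ne'⟩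
  obtain ⟨Dm⟩ := hmodD V
  obtain ⟨ϖ, hϖ⟩ := exists_periodRatio_parity (p := 3) V Dm
  have hord : IsOrdinaryAt V 3 :=
    isOrdinaryAt_of_goodOrd_or_mult_of_model_twist W V (pStar_ne_zero 3) ⟨C, hC⟩
      (padicValRat_j_nonneg_of_typeGOrd W 3 hX.typeGOrd) (Or.inl hV)
  -- the record gives `c₁(ϖB) ≠ 0` and its valuation `v₁` on THIS datum; the Q6 record is the certificate
  obtain ⟨hne₁, hval⟩ := hv1.coeff_ne_zero_and_valuation_eq V C hC hord Dm.f Dm.isNewformOf ϖ hϖ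
  have hcert : BranchUnitCoeffAt W 3 n₀ :=
    CensusQ6.branchUnitCoeffAt_of_gordOddFirstUnitIndexAt (by decide) hrec
  obtain ⟨ℓ, hℓ, hℓ1, m, d, hm, hd, hid⟩ :=
    hX.kuriharaGap_identity_three_rankOne_of_kimPartial_of_katoHalf_of_coeffCert_of_budget h3 hKato hGZK
      hmod hsurj hr hcert hbud V C hC hV Dm.isNewformOf ϖ hϖ hne₁ hB D hc hper hne
  refine ⟨ℓ, hℓ, hℓ1, m, d, hm, hd, ?_⟩
  rw [hval] at hid
  exact hid

/-- **K1-n₀ (G-ord), `p = 3`, gap form on the SCORED (non-anomalous) rows** (register A1 list, `a₃(E♭) ≢ 1`):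
`ℓ = 1`, so **`∂^{(1)} − ∂^{(∞)} + v(Reg₃(E,Dh)) + ord₃ ∏c = v₁ + 1 + 2·ord₃ #E(ℚ)_tors`**. Per pair;
nothing booked. [cite: Kim2022StructureSelmer, Thm. 1.9 (6) (PDF p. 8)]
[cite: Kato2004Asterisque, Thm. 17.4 (3) (p. 273)] [cite: Delbourgo2002, Theorem (B), ℓ_p = 1 (pp. 39–40)] -/
theorem ClassX4Gord.kuriharaGap_identity_three_rankOne_of_kimPartial_of_katoHalf_of_gordOddFirstUnitIndexAt_of_gordCoeffValAt_of_budget_of_nonAnomalous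
    (h3 : X4SharpThreeKimRankOnePartial)
    (hKato : Wuthrich2014.kato_halfEigenCharIdeal_dvd_cyclotomicPrime_of_surjective)
    (hmodD : nonempty_modularParametrizationData)
    (hGZK : rank_eq_analyticRank_of_analyticRank_le_one) (hmod : hasEntireLFunction_rat)
    (hX : ClassX4Gord W 3) (hsurj : Surj W 3) (hna : ReductionNonAnomalous W 3) (hr : W.analyticRank = 1)
    {n₀ : ℕ} (hrec : CensusQ6.GordOddFirstUnitIndexAt W 3 n₀) (hbud : BudgetLeLambdaAt 3 W n₀)
    {v₁ : ℤ} (hv1 : CensusQ6.GordCoeffValAt W 3 1 v₁)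
    {Dh : PAdicHeightData W 3} (hB : LeadingTermClauses W 3 Dh)
    {N : ℕ} [NeZero N] (D : ModularParametrizationData W N) (hc : ¬ (3 : ℤ) ∣ D.maninConstant)
    (hper : ∃ u : ℚ, ‖(u : ℚ_[3])‖ = 1 ∧ W.realPeriodRat = u * plusPeriod D.f)
    (hne : kuriharaPartial W 3 D.f 1 ≠ ⊤) :
    ∃ m d : ℕ, kuriharaPartial W 3 D.f 1 = m ∧ kuriharaPartialInfty W 3 D.f = d ∧
      (m : ℤ) - d + (padicRegulator Dh).valuation + padicValNat 3 W.tamagawaProduct =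
        v₁ + 1 + 2 * padicValNat 3 W.torsionOrder := by
  obtain ⟨ℓ, -, hℓ1, m, d, hm, hd, hid⟩ :=
    hX.kuriharaGap_identity_three_rankOne_of_kimPartial_of_katoHalf_of_gordOddFirstUnitIndexAt_of_gordCoeffValAt_of_budget
      h3 hKato hmodD hGZK hmod hsurj hr hrec hbud hv1 hB D hc hper hne
  refine ⟨m, d, hm, hd, ?_⟩
  rw [hℓ1 hna, padicValNat_one_right, Nat.cast_zero, add_zero] at hid
  exact hid

/-- **K1-n₀ (G-ord), `p = 3`, WITH Kim's Conjecture 1.10 at the pair** (`hT`, a HYPOTHESIS) — the JOINT test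
{`X4SharpThreeKimRankOnePartial` ∧ Conj. 1.10} in the joint table's columns:
**`∂^{(1)} + v(Reg₃(E,Dh)) + ord₃ ℓ = v₁ + 1`** (`3 ∤ #E(ℚ)_tors`). Per pair; nothing booked.
[cite: Kim2022StructureSelmer, Thm. 1.9 (6), Conj. 1.10 (PDF p. 8)] [cite: Kato2004Asterisque, Thm. 17.4 (3) (p. 273)]
[cite: Delbourgo2002, Theorem (B) (p. 40)] -/
theorem ClassX4Gord.kuriharaPartial_one_identity_three_rankOne_of_kimPartial_of_tamagawaDefect_of_gordOddFirstUnitIndexAt_of_gordCoeffValAt_of_budget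
    (h3 : X4SharpThreeKimRankOnePartial)
    (hKato : Wuthrich2014.kato_halfEigenCharIdeal_dvd_cyclotomicPrime_of_surjective)
    (hmodD : nonempty_modularParametrizationData)
    (hGZK : rank_eq_analyticRank_of_analyticRank_le_one) (hmod : hasEntireLFunction_rat)
    (hX : ClassX4Gord W 3) (hsurj : Surj W 3) (hr : W.analyticRank = 1) {n₀ : ℕ}
    (hrec : CensusQ6.GordOddFirstUnitIndexAt W 3 n₀) (hbud : BudgetLeLambdaAt 3 W n₀)
    {v₁ : ℤ} (hv1 : CensusQ6.GordCoeffValAt W 3 1 v₁)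
    {Dh : PAdicHeightData W 3} (hB : LeadingTermClauses W 3 Dh)
    {N : ℕ} [NeZero N] (D : ModularParametrizationData W N) (hc : ¬ (3 : ℤ) ∣ D.maninConstant)
    (hper : ∃ u : ℚ, ‖(u : ℚ_[3])‖ = 1 ∧ W.realPeriodRat = u * plusPeriod D.f)
    (hne : kuriharaPartial W 3 D.f 1 ≠ ⊤) (hT : X4.KimTamagawaDefectAt W 3 D.f) :
    ∃ ℓ : ℕ, ℓ ∣ 3 ^ 2 ∧ (ReductionNonAnomalous W 3 → ℓ = 1) ∧
      ∃ m : ℕ, kuriharaPartial W 3 D.f 1 = m ∧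
        (m : ℤ) + (padicRegulator Dh).valuation + padicValNat 3 ℓ = v₁ + 1 := by
  obtain ⟨ℓ, hℓ, hℓ1, m, d, hm, hd, hid⟩ :=
    hX.kuriharaGap_identity_three_rankOne_of_kimPartial_of_katoHalf_of_gordOddFirstUnitIndexAt_of_gordCoeffValAt_of_budget
      h3 hKato hmodD hGZK hmod hsurj hr hrec hbud hv1 hB D hc hper hne
  have htors0 : padicValNat 3 W.torsionOrder = 0 :=
    padicValNat_torsionOrder_eq_zero_of_irreducible W 3 hX.1.2.2
  unfold X4.KimTamagawaDefectAt at hT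
  have hdT : (d : ℕ∞) = (padicValNat 3 W.tamagawaProduct : ℕ∞) := hd.symm.trans hT
  have hdT' : d = padicValNat 3 W.tamagawaProduct := by exact_mod_cast hdT
  refine ⟨ℓ, hℓ, hℓ1, m, hm, ?_⟩
  rw [htors0, hdT'] at hid
  simp only [Nat.cast_zero, mul_zero, add_zero] at hid
  linarith

/-- **K1-n₀ (G-ord), `p = 3`, WITH Conj. 1.10, on the SCORED (non-anomalous) rows**: **`∂^{(1)} + v(Reg₃(E,Dh)) = v₁ + 1`**
— the register's literal K1-n₀ sentence. Per pair; nothing booked.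
[cite: Kim2022StructureSelmer, Thm. 1.9 (6), Conj. 1.10 (PDF p. 8)] [cite: Kato2004Asterisque, Thm. 17.4 (3) (p. 273)]
[cite: Delbourgo2002, Theorem (B), ℓ_p = 1 (pp. 39–40)] -/
theorem ClassX4Gord.kuriharaPartial_one_add_regulator_eq_three_of_kimPartial_of_tamagawaDefect_of_gordOddFirstUnitIndexAt_of_gordCoeffValAt_of_budget_of_nonAnomalous
    (h3 : X4SharpThreeKimRankOnePartial)
    (hKato : Wuthrich2014.kato_halfEigenCharIdeal_dvd_cyclotomicPrime_of_surjective)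
    (hmodD : nonempty_modularParametrizationData)
    (hGZK : rank_eq_analyticRank_of_analyticRank_le_one) (hmod : hasEntireLFunction_rat)
    (hX : ClassX4Gord W 3) (hsurj : Surj W 3) (hna : ReductionNonAnomalous W 3) (hr : W.analyticRank = 1)
    {n₀ : ℕ} (hrec : CensusQ6.GordOddFirstUnitIndexAt W 3 n₀) (hbud : BudgetLeLambdaAt 3 W n₀)
    {v₁ : ℤ} (hv1 : CensusQ6.GordCoeffValAt W 3 1 v₁)
    {Dh : PAdicHeightData W 3} (hB : LeadingTermClauses W 3 Dh)
    {N : ℕ} [NeZero N] (D : ModularParametrizationData W N) (hc : ¬ (3 : ℤ) ∣ D.maninConstant)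
    (hper : ∃ u : ℚ, ‖(u : ℚ_[3])‖ = 1 ∧ W.realPeriodRat = u * plusPeriod D.f)
    (hne : kuriharaPartial W 3 D.f 1 ≠ ⊤) (hT : X4.KimTamagawaDefectAt W 3 D.f) :
    ∃ m : ℕ, kuriharaPartial W 3 D.f 1 = m ∧ (m : ℤ) + (padicRegulator Dh).valuation = v₁ + 1 := by
  obtain ⟨ℓ, -, hℓ1, m, hm, hid⟩ :=
    hX.kuriharaPartial_one_identity_three_rankOne_of_kimPartial_of_tamagawaDefect_of_gordOddFirstUnitIndexAt_of_gordCoeffValAt_of_budget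
      h3 hKato hmodD hGZK hmod hsurj hr hrec hbud hv1 hB D hc hper hne hT
  refine ⟨m, hm, ?_⟩
  rw [hℓ1 hna, padicValNat_one_right, Nat.cast_zero, add_zero] at hid
  exact hid

end Three

end Summit.BirchSwinnertonDyer.Rank1Residual.Additive

/-! ### §2 `p = 3`, (M): K1-M-n₀ in RECORD-LITERAL form -/

namespace Summit.BirchSwinnertonDyer.Rank1Residual.AdditivePotMult

open CongruenceSubgroup WeierstrassCurve NumberField Literature.NumberTheory.EllipticCurves
  Literature.NumberTheory.EllipticCurves.ModularForms
  Literature.NumberTheory.EllipticCurves.Rank1Residual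
  Literature.NumberTheory.EllipticCurves.Rank1Residual.Typed
  Literature.NumberTheory.EllipticCurves.Delbourgo2002
  Literature.NumberTheory.GaloisRepresentations
  Summit.BirchSwinnertonDyer.Rank1Residual.Additive
  IsDedekindDomain

section Three

variable {W : WeierstrassCurve ℚ} [W.IsElliptic] [W.IsGloballyMinimal] [hp : Fact (Nat.Prime 3)]

/-- **K1-M-n₀, `p = 3`, gap form, RECORD-LITERAL**: X4(M)@3 ∩ {`ρ̄₃` onto}, `r_an = 1`, Q6 ODD record at `n₀`
(`CensusQ6.MultOddFirstUnitIndexAt W 3 n₀`, column `n0`) + budget at `3` + (M) valuation record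
`CensusQ6.MultCoeffValAt W 3 1 v₁` (column `v1`) + (B)-datum + parametrisation datum with ONE non-zero
Kurihara number: **`∂^{(1)} − ∂^{(∞)} + v(Reg₃(E,Dh)) + ord₃ ∏c = v₁ + 1 + 2·ord₃ #E(ℚ)_tors`** — modulo OUR
conjecture `X4SharpThreeKimRankOnePartial` + Kato 17.4 (3) + GZK + modularity + `hmodD`; NO Conj. 1.10.
The multiplicative twist datum is DISCHARGED (`ClassX4M.exists_mult_pStar_twist_model`, `a₃(f♭) = ±1`
by the reduction sign, period ratio of the parity; `v₁` read off the record). Per pair; nothing booked.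
[cite: Kim2022StructureSelmer, Thm. 1.9 (6) (PDF p. 8)] [cite: Kato2004Asterisque, Thm. 17.4 (3) (p. 273)]
[cite: Delbourgo2002, Theorem (B) (p. 40)] [cite: MazurTateTeitelbaum1986Invent, §I.10 (the record; nothing asserted)] -/
theorem ClassX4M.kuriharaGap_identity_three_rankOne_of_kimPartial_of_katoHalf_of_multOddFirstUnitIndexAt_of_multCoeffValAt_of_budget
    (h3 : X4SharpThreeKimRankOnePartial)
    (hKato : Wuthrich2014.kato_halfEigenCharIdeal_dvd_cyclotomicPrime_of_surjective)
    (hmodD : nonempty_modularParametrizationData)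
    (hGZK : rank_eq_analyticRank_of_analyticRank_le_one) (hmod : hasEntireLFunction_rat)
    (hX : ClassX4M W 3) (hsurj : Surj W 3) (hr : W.analyticRank = 1) {n₀ : ℕ}
    (hrec : CensusQ6.MultOddFirstUnitIndexAt W 3 n₀) (hbud : BudgetLeLambdaAt 3 W n₀)
    {v₁ : ℤ} (hv1 : CensusQ6.MultCoeffValAt W 3 1 v₁)
    {Dh : PAdicHeightData W 3} (hB : LeadingTermClauses W 3 Dh)
    {N : ℕ} [NeZero N] (D : ModularParametrizationData W N) (hc : ¬ (3 : ℤ) ∣ D.maninConstant)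
    (hper : ∃ u : ℚ, ‖(u : ℚ_[3])‖ = 1 ∧ W.realPeriodRat = u * plusPeriod D.f)
    (hne : kuriharaPartial W 3 D.f 1 ≠ ⊤) :
    ∃ m d : ℕ, kuriharaPartial W 3 D.f 1 = m ∧ kuriharaPartialInfty W 3 D.f = d ∧
      (m : ℤ) - d + (padicRegulator Dh).valuation + padicValNat 3 W.tamagawaProduct =
        v₁ + 1 + 2 * padicValNat 3 W.torsionOrder := by
  obtain ⟨V, iV, iVm, C, hV, hC⟩ := hX.exists_mult_pStar_twist_model
  haveI : NeZero (V.conductorNorm ℤ) := ⟨(V.conductorNorm_pos_holds).ne'⟩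
  obtain ⟨Dm⟩ := hmodD V
  obtain ⟨ϖ, hϖ⟩ := exists_periodRatio_parity (p := 3) V Dm
  -- `a₃(E♭) = ±1` by the reduction sign
  obtain ⟨ap, hap⟩ : ∃ ap : ℤ, cuspCoeff Dm.f 3 = ap := by
    by_cases hs : V.HasSplitMultiplicativeReductionAtPrime 3
    · exact ⟨1, by exact_mod_cast (Dm.isNewformOf.cuspCoeff_eq_one_and_sq_of_split hs).1⟩
    · exact ⟨-1, by exact_mod_cast (Dm.isNewformOf.cuspCoeff_eq_neg_one_and_dvd_of_nonsplit hV hs).1⟩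
  obtain ⟨hne₁, hval⟩ := hv1.coeff_ne_zero_and_valuation_eq V C hV hC Dm.f Dm.isNewformOf ap hap ϖ hϖ
  obtain ⟨m, d, hm, hd, hid⟩ :=
    hX.kuriharaGap_identity_three_rankOne_of_kimPartial_of_katoHalf_of_firstUnitIndex_of_budget h3 hKato
      hGZK hmod hsurj hr hrec hbud V C hV hC Dm.isNewformOf ap hap ϖ hϖ hne₁ hB D hc hper hne
  refine ⟨m, d, hm, hd, ?_⟩
  rw [hval] at hid
  exact hid

/-- **K1-M-n₀, `p = 3`, WITH Kim's Conjecture 1.10 at the pair** (`hT`, a HYPOTHESIS) — the JOINT test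
{`X4SharpThreeKimRankOnePartial` ∧ Conj. 1.10} on (M)@3 in the joint table's columns:
**`∂^{(1)} + v(Reg₃(E,Dh)) = v₁ + 1`** (`3 ∤ #E(ℚ)_tors`). Per pair; nothing booked.
[cite: Kim2022StructureSelmer, Thm. 1.9 (6), Conj. 1.10 (PDF p. 8)] [cite: Kato2004Asterisque, Thm. 17.4 (3) (p. 273)]
[cite: Delbourgo2002, Theorem (B) (p. 40)] -/
theorem ClassX4M.kuriharaPartial_one_identity_three_rankOne_of_kimPartial_of_tamagawaDefect_of_multOddFirstUnitIndexAt_of_multCoeffValAt_of_budget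
    (h3 : X4SharpThreeKimRankOnePartial)
    (hKato : Wuthrich2014.kato_halfEigenCharIdeal_dvd_cyclotomicPrime_of_surjective)
    (hmodD : nonempty_modularParametrizationData)
    (hGZK : rank_eq_analyticRank_of_analyticRank_le_one) (hmod : hasEntireLFunction_rat)
    (hX : ClassX4M W 3) (hsurj : Surj W 3) (hr : W.analyticRank = 1) {n₀ : ℕ}
    (hrec : CensusQ6.MultOddFirstUnitIndexAt W 3 n₀) (hbud : BudgetLeLambdaAt 3 W n₀)
    {v₁ : ℤ} (hv1 : CensusQ6.MultCoeffValAt W 3 1 v₁)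
    {Dh : PAdicHeightData W 3} (hB : LeadingTermClauses W 3 Dh)
    {N : ℕ} [NeZero N] (D : ModularParametrizationData W N) (hc : ¬ (3 : ℤ) ∣ D.maninConstant)
    (hper : ∃ u : ℚ, ‖(u : ℚ_[3])‖ = 1 ∧ W.realPeriodRat = u * plusPeriod D.f)
    (hne : kuriharaPartial W 3 D.f 1 ≠ ⊤) (hT : X4.KimTamagawaDefectAt W 3 D.f) :
    ∃ m : ℕ, kuriharaPartial W 3 D.f 1 = m ∧ (m : ℤ) + (padicRegulator Dh).valuation = v₁ + 1 := by
  obtain ⟨m, d, hm, hd, hid⟩ :=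
    hX.kuriharaGap_identity_three_rankOne_of_kimPartial_of_katoHalf_of_multOddFirstUnitIndexAt_of_multCoeffValAt_of_budget
      h3 hKato hmodD hGZK hmod hsurj hr hrec hbud hv1 hB D hc hper hne
  have htors0 : padicValNat 3 W.torsionOrder = 0 :=
    padicValNat_torsionOrder_eq_zero_of_irreducible W 3 hX.classX4.2.2
  unfold X4.KimTamagawaDefectAt at hT
  have hdT : (d : ℕ∞) = (padicValNat 3 W.tamagawaProduct : ℕ∞) := hd.symm.trans hT
  have hdT' : d = padicValNat 3 W.tamagawaProduct := by exact_mod_cast hdT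
  refine ⟨m, hm, ?_⟩
  rw [htors0, hdT'] at hid
  simp only [Nat.cast_zero, mul_zero, add_zero] at hid
  linarith

end Three

end Summit.BirchSwinnertonDyer.Rank1Residual.AdditivePotMult
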